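import Mathlib

/-!
# Tier4/Common/FundamentalDomainProduct — a fundamental domain with a FREE first coordinate: `univ ×ˢ S` for a subgroup of
`H₁ × H₂` on which the second projection is injective, and its transport along `e : G ≃ₜ* H₁ × H₂`

Blind re-derivation cell `pub-hodge-repro`, Tier 4 (README §9–§10), seat t4-typer-1 (gen 2).  Target tree path
`lean/Summits/Ventures/HodgeRepro/Tier4/Common/FundamentalDomainProduct.lean`.  Imports Mathlib only; companion of
`HaarProductTransport` (p694668) and `HaarProductIntegralMul` (p694998), not imported here.

WHAT IS TYPED — the GENERIC core of plan-4's cut C-L4-ZDOMAIN (Factorisation-STATEMENTS-v2 Part 3, S14430 / S14455: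
`isFundamentalDomain_prodDomain`: «if `DZ_f` is a fundamental domain for the image of `Z(k)` in `T_f`, then `T_∞ × DZ_f` is a
fundamental domain for `Z(k)` in `T(𝔸)` — the archimedean coordinate is free because `Z(k) → T_f` is injective»):
* (A) **`isFundamentalDomain_univ_prod`** (product level): `Z' ≤ H₁ × H₂` with `snd` injective on `Z'`
  (`∀ w ∈ Z', w.2 = 1 → w = 1`), `S ⊆ H₂` measurable, `S` a fundamental domain for `Z'.map snd` acting on `H₂` (measure `ν₂`)
  ⇒ `univ ×ˢ S` is a fundamental domain for `Z'` acting on `H₁ × H₂` (measure `ν₁.prod ν₂`, `ν₁`, `ν₂` s-finite).  The three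
  fields of Mathlib's `IsFundamentalDomain` by hand: `ae_covers` through `(ν₁.prod ν₂) (univ ×ˢ N) = ν₁ univ * ν₂ N` with
  `ν₂ N = 0`; `aedisjoint` through `w • (univ ×ˢ S) = univ ×ˢ (w.2 • S)` and the `ν₂`-a.e. disjointness of `w.2 • S`, `w'.2 • S`
  for `w ≠ w'` (`w.2 ≠ w'.2` by the injectivity).
* (B) **`isFundamentalDomain_image_symm_univ_prod`** (transport): `e : G ≃ₜ* H₁ × H₂`, `Z ≤ G` with `z ↦ (e z).2` injective on
  `Z`, `μ = c • Measure.map e.symm (ν₁.prod ν₂)`, `S` a fundamental domain for `Z.map (snd ∘ e)` ⇒ `e.symm '' (univ ×ˢ S)` is a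
  fundamental domain for `Z` acting on `G` (measure `μ`) — (A) at `Z' := Z.map e` and Mathlib's
  `IsFundamentalDomain.image_of_equiv` along `e.symm` (`QuasiMeasurePreserving e μ (ν₁.prod ν₂)` since
  `Measure.map e μ = c • (ν₁.prod ν₂)`).
At `e := torusSplit W`, `Z := rationalCentreT W` the binder `hinj` is plan-4's `eq_one_of_mem_rationalCentreT_of_finTfHom_eq_one`,
`Z.map (snd ∘ e)` is `centreFin W` and `e.symm '' (univ ×ˢ DZf)` is `prodDomain W DZf`, by the definitions.

Nothing here says anything about the status of the Hodge conjecture for CM abelian varieties, which is NOT proved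
(HC_CM is NOT proved by anyone in this repository).
-/

set_option autoImplicit false

noncomputable section

open MeasureTheory Measure Set Function
open scoped NNReal ENNReal Pointwise

namespace Summit.Ventures.HodgeRepro.Tier4.Common

section ProductLevel

variable {H₁ H₂ : Type*} [Group H₁] [MeasurableSpace H₁] [Group H₂] [MeasurableSpace H₂]

omit [MeasurableSpace H₁] [MeasurableSpace H₂] in
/-- The translate of `univ ×ˢ S` by an element `v` of a subgroup of `H₁ × H₂` is `univ ×ˢ (v.2 • S)`. -/
theorem smul_univ_prod (Z' : Subgroup (H₁ × H₂)) (v : Z') (S : Set H₂) :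
    v • ((univ : Set H₁) ×ˢ S) = (univ : Set H₁) ×ˢ ((v : H₁ × H₂).2 • S) := by
  ext p
  simp only [Subgroup.smul_def, smul_eq_mul, mem_smul_set, mem_prod, mem_univ, true_and]
  constructor
  · rintro ⟨q, hq, rfl⟩
    exact ⟨q.2, hq, rfl⟩
  · rintro ⟨b, hb, hb'⟩
    refine ⟨((v : H₁ × H₂).1⁻¹ * p.1, b), hb, Prod.ext ?_ ?_⟩
    · simp only [Prod.fst_mul, mul_inv_cancel_left]
    · simpa only [Prod.snd_mul] using hb'

/-- **(A) A fundamental domain with a free first coordinate.**  If the second projection is injective on `Z' ≤ H₁ × H₂`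
and `S` is a fundamental domain for the image `Z'.map snd` acting on `H₂`, then `univ ×ˢ S` is a fundamental domain for `Z'`
acting on `H₁ × H₂` (product measure, s-finite factors). -/
theorem isFundamentalDomain_univ_prod (Z' : Subgroup (H₁ × H₂)) (hinj : ∀ w ∈ Z', w.2 = 1 → w = 1)
    (ν₁ : Measure H₁) [SFinite ν₁] (ν₂ : Measure H₂) [SFinite ν₂]
    (S : Set H₂) (hS : MeasurableSet S) (hfd : IsFundamentalDomain (Z'.map (MonoidHom.snd H₁ H₂)) S ν₂) :
    IsFundamentalDomain Z' ((univ : Set H₁) ×ˢ S) (ν₁.prod ν₂) where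
  nullMeasurableSet := (MeasurableSet.univ.prod hS).nullMeasurableSet
  ae_covers := by
    have h2 := hfd.ae_covers
    rw [ae_iff] at h2 ⊢
    refine measure_mono_null (fun p hp => ?_)
      (show (ν₁.prod ν₂) ((univ : Set H₁) ×ˢ
        {b : H₂ | ¬ ∃ g : ↥(Z'.map (MonoidHom.snd H₁ H₂)), g • b ∈ S}) = 0 by rw [prod_prod, h2, mul_zero])
    refine ⟨mem_univ _, fun ⟨g, hg⟩ => hp ?_⟩
    obtain ⟨w, hw, hwg⟩ := g.2
    refine ⟨⟨w, hw⟩, mem_univ _, ?_⟩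
    show (w * p).2 ∈ S
    rw [Prod.snd_mul]
    have : w.2 = (g : H₂) := hwg
    rw [this]
    exact hg
  aedisjoint := by
    intro w w' hww'
    have h2 : (w : H₁ × H₂).2 ≠ (w' : H₁ × H₂).2 := by
      intro h
      apply hww'
      apply Subtype.ext
      have := hinj ((w : H₁ × H₂) * (w' : H₁ × H₂)⁻¹) (Z'.mul_mem w.2 (Z'.inv_mem w'.2))
        (by rw [Prod.snd_mul, Prod.snd_inv, h, mul_inv_cancel])
      exact mul_inv_eq_one.1 this
    have hd := hfd.aedisjoint (show (⟨(w : H₁ × H₂).2, Subgroup.mem_map_of_mem _ w.2⟩ :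
        ↥(Z'.map (MonoidHom.snd H₁ H₂))) ≠ ⟨(w' : H₁ × H₂).2, Subgroup.mem_map_of_mem _ w'.2⟩ from
      fun h => h2 (congrArg Subtype.val h))
    show (ν₁.prod ν₂) (w • ((univ : Set H₁) ×ˢ S) ∩ w' • ((univ : Set H₁) ×ˢ S)) = 0
    rw [smul_univ_prod, smul_univ_prod, prod_inter_prod, univ_inter, prod_prod]
    have : ν₂ ((w : H₁ × H₂).2 • S ∩ (w' : H₁ × H₂).2 • S) = 0 := hd
    rw [this, mul_zero]

end ProductLevel

section Transport

variable {G H₁ H₂ : Type*}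
  [Group G] [TopologicalSpace G] [MeasurableSpace G] [BorelSpace G]
  [Group H₁] [TopologicalSpace H₁] [MeasurableSpace H₁] [BorelSpace H₁]
  [Group H₂] [TopologicalSpace H₂] [MeasurableSpace H₂] [BorelSpace H₂] [SecondCountableTopology H₂]

/-- The push-forward of `c • Measure.map e.symm (ν₁.prod ν₂)` along `e` is `c • (ν₁.prod ν₂)`. -/
theorem map_smul_map_symm (e : G ≃ₜ* H₁ × H₂) (ν₁ : Measure H₁) (ν₂ : Measure H₂) (c : ℝ≥0) :
    Measure.map e (c • Measure.map e.symm (ν₁.prod ν₂)) = c • ν₁.prod ν₂ := by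
  have hm : Measurable (e : G → H₁ × H₂) := e.continuous.measurable
  have hm' : Measurable (e.symm : H₁ × H₂ → G) := e.symm.continuous.measurable
  rw [Measure.map_smul, Measure.map_map hm hm']
  have : ((e : G → H₁ × H₂) ∘ (e.symm : H₁ × H₂ → G)) = id := funext fun p => e.apply_symm_apply p
  rw [this, Measure.map_id]

/-- `e : G ≃ₜ* H₁ × H₂` is quasi-measure-preserving from `c • Measure.map e.symm (ν₁.prod ν₂)` to `ν₁.prod ν₂`. -/
theorem quasiMeasurePreserving_smul_map_symm (e : G ≃ₜ* H₁ × H₂) (ν₁ : Measure H₁) (ν₂ : Measure H₂)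
    (c : ℝ≥0) :
    QuasiMeasurePreserving e (c • Measure.map e.symm (ν₁.prod ν₂)) (ν₁.prod ν₂) :=
  ⟨e.continuous.measurable, by rw [map_smul_map_symm]; exact smul_absolutelyContinuous⟩

/-- **(B) Transport of the free-coordinate fundamental domain along `e : G ≃ₜ* H₁ × H₂`.**  For `Z ≤ G` on which
`z ↦ (e z).2` is injective, `μ = c • Measure.map e.symm (ν₁.prod ν₂)`, and `S` a fundamental domain for `Z.map (snd ∘ e)`
acting on `H₂` (measure `ν₂`), the set `e.symm '' (univ ×ˢ S)` is a fundamental domain for `Z` acting on `G` (measure `μ`). -/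
theorem isFundamentalDomain_image_symm_univ_prod (e : G ≃ₜ* H₁ × H₂) (Z : Subgroup G)
    (hinj : ∀ z ∈ Z, (e z).2 = 1 → z = 1)
    (ν₁ : Measure H₁) [SFinite ν₁] (ν₂ : Measure H₂) [SFinite ν₂] (μ : Measure G) (c : ℝ≥0)
    (hc : μ = c • Measure.map e.symm (ν₁.prod ν₂)) (S : Set H₂) (hS : MeasurableSet S)
    (hfd : IsFundamentalDomain (Z.map ((MonoidHom.snd H₁ H₂).comp (e.toMulEquiv : G →* H₁ × H₂))) S ν₂) :
    IsFundamentalDomain Z (e.symm '' ((univ : Set H₁) ×ˢ S)) μ := by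
  subst hc
  have hZ' : ∀ w ∈ Z.map (e.toMulEquiv : G →* H₁ × H₂), w.2 = 1 → w = 1 := by
    rintro w ⟨z, hz, rfl⟩ h2
    rw [hinj z hz h2, map_one]
  have hmap : (Z.map (e.toMulEquiv : G →* H₁ × H₂)).map (MonoidHom.snd H₁ H₂) =
      Z.map ((MonoidHom.snd H₁ H₂).comp (e.toMulEquiv : G →* H₁ × H₂)) := Subgroup.map_map _ _ _
  have hA := isFundamentalDomain_univ_prod (Z.map (e.toMulEquiv : G →* H₁ × H₂)) hZ' ν₁ ν₂ S hS
    (hmap ▸ hfd)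
  refine hA.image_of_equiv e.symm.toEquiv (quasiMeasurePreserving_smul_map_symm e ν₁ ν₂ c)
    (e.toMulEquiv.subgroupMap Z).toEquiv fun z p => ?_
  show e.symm (((e.toMulEquiv.subgroupMap Z) z : H₁ × H₂) * p) = (z : G) * e.symm p
  rw [MulEquiv.coe_subgroupMap_apply, map_mul]
  exact congrArg (fun y => y * e.symm p) (e.symm_apply_apply (z : G))

end Transport

end Summit.Ventures.HodgeRepro.Tier4.Common
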